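import Literature.NumberTheory.Automorphic.RegularAlgebraicCuspidalHeckePointEigenclassProofs
import Literature.NumberTheory.Automorphic.PrincipalPowerTowerHeckePointDescent
import Literature.NumberTheory.Automorphic.TwistedQuotientRationalEigenclassLattice
import Literature.NumberTheory.Automorphic.PadicCoeffUnitBallLattice
import Literature.NumberTheory.Automorphic.FinitelyManyComponentsGLn
import Literature.NumberTheory.Automorphic.PSquaredLevelStabilizerTorsionFree
import Literature.NumberTheory.Automorphic.TwistedQuotientLevelPullback
import Literature.Algebra.Module.EigenvalueLatticeIntegral
import HarnessLib

/-!
# `bianchi_regularAlgebraicCuspidal_isHeckePoint` from the Eichler–Shimura–Harder existence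
# statement and the Borel–Serre finiteness (type `FL`) of torsion-free arithmetic groups

Topic `NumberTheory/Automorphic`; namespace `Literature.NumberTheory.Automorphic`.
Theorems only; no definition, no named fact, no instance, no `sorry`.

**`bianchi_regularAlgebraicCuspidal_isHeckePoint_of_eigenclassExists_of_typeFL`** proves the
named fact `bianchi_regularAlgebraicCuspidal_isHeckePoint` (Scholze's Cor. V.4.2 in the form
"the `p`-adically normalised Satake eigenvalues of a regular algebraic cuspidal `π` on `GL₂` over an
imaginary quadratic field form a `ℤ̄_p`-point of the big Hecke algebra `𝕋` of the `p`-power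
principal congruence tower") from exactly two inputs which are not (yet) theorems of the tree:

* `hX : bianchi_cuspidal_regularLAlgebraic_eigenclassExists` — the Eichler–Shimura–Harder
  occurrence of `π` in the cohomology of the Bianchi manifolds [Harder1987], [Clozel1990, 3.14],
  a named fact of `BianchiCuspidalEigenclass`;
* `hFL` — Borel–Serre AS PRINTED: every TORSION-FREE arithmetic subgroup `Γ` of `GL_n(K)` (a
  subgroup commensurable with `GL_n(𝓞_K)`; `K` a number field) is of type `FL` over every
  commutative ring `k`: the trivial `k[Γ]`-module `k` admits a projective resolution by free
  modules of finite rank ([BorelSerre1973, §11.1 (c): "a triangulation of `X̄/Γ` lifts to a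
  `Γ`-invariant triangulation of `X̄` and the corresponding complex of simplicial chains … gives a
  `ℤ[Γ]`-free resolution of finite type"; 11.6 for `R_{K/ℚ} GL_n`]).  This is the same explicit
  hypothesis as in the tree's `…_of_typeFL_torsionFree` reductions
  (`ArithmeticQuotientCohomologyFiniteProofs`, `ArithmeticGroupCohomologyFinitenessProofs`); it is
  applied to the stabilisers `Γ_x = GL₂(K) ∩ x U₀ x⁻¹`, which are arithmetic
  (`commensurable_orbitStabilizer_glIntegers`) and torsion-free once the level is shrunk into
  `K_f(p²)` at `p ∈ S₀` (`PSquaredLevelStabilizerTorsionFree`; the eigenclass is pulled back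
  injectively and Hecke-equivariantly at the good places, `TwistedQuotientLevelPullback`,
  `UnramifiedLevelChange`).

Assembly (`[Scholze2015, §V.4, proofs of Thm. V.4.1 and Cor. V.4.2]`): the `ℚ̄_p`-eigenclass `ξ`
(`RegularAlgebraicCuspidalHeckePointEigenclassProofs`) is moved to the `p`-adic coefficient
representation (`ResGLnAdelicCoefficients.cohomologyIsoPadic`) and to `𝒪_E`-scalars
(`TwistedQuotientRestrictScalars`); its eigenvalues lie in a finite `E₁/ℚ_p` and are `p`-adically
integral (`EigenvalueLattice`, `EigenvalueLatticeIntegral`, through the finitely generated image of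
the lattice cohomology, `TwistedQuotientRationalEigenclassLattice.exists_intFun_map_eq`); over
`𝒪_{E₁}` the class comes from an exact integral eigenclass of bounded content on a free lattice
(`exists_intFun_exact_eigenclass`, lattice `M_λ(𝒪_{E₁})` of `PadicCoeffUnitBallLattice`), which is
a `ℤ̄_p`-point of `𝕋` by `PrincipalPowerTowerHeckePointDescent`; the values are identified through
the uniqueness of Satake parameters (`hasSatakeParamAt_unique_holds`).

## References

* P. Scholze, *On torsion in the cohomology of locally symmetric varieties*, Ann. of Math. 182
  (2015), §V.4, Thm. V.4.1, Cor. V.4.2. [Scholze2015]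
* A. Borel, J.-P. Serre, *Corners and arithmetic groups*, Comment. Math. Helv. 48 (1973), §11.
  [BorelSerre1973]
* K. S. Brown, *Cohomology of Groups*, GTM 87 (1982), VIII (5.1). [Brown1982CohomologyGroups]
* L. Clozel, *Motifs et formes automorphes* (1990), 3.14; G. Harder (1987). [Clozel1990]
-/

noncomputable section

open CategoryTheory
open scoped NumberField
open IsDedekindDomain NumberField

namespace Literature.NumberTheory.Automorphic

open TwistedQuotient BigHeckeGLn PadicIntermediateField ResGLnCohomology ParallelWeight
  Literature.Algebra.Module

/-! ### Small helpers -/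

section Helpers

variable (p : ℕ) [Fact p.Prime]

/-- An element of a finite `E ⊆ ℚ̄_p` which is integral over `ℤ_p` lies in the unit ball `𝒪_E`.
[cite: NeukirchANT1999, Ch. II (6.2)] -/
theorem mem_unitBall_of_isIntegral (E : IntermediateField ℚ_[p] (PadicAlgCl p)) {x : PadicAlgCl p}
    (hxE : x ∈ E) (hx : IsIntegral ℤ_[p] x) : x ∈ unitBall p E := by
  have hx' : IsIntegral ℤ_[p] (⟨x, hxE⟩ : E) := (isIntegral_field_iff p E ⟨x, hxE⟩).2 hx
  obtain ⟨y, hy⟩ := IsIntegralClosure.isIntegral_iff (A := unitBall p E) |>.1 hx'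
  have : (y : PadicAlgCl p) = x := by
    have h := congrArg (fun z : E => (z : PadicAlgCl p)) hy
    simpa [coe_algebraMap_unitBall] using h
  rw [← this]
  exact y.2

/-- `resScalars R (π ∘ ι) = (resScalars R π) ∘ ι` (definitional). [folklore] -/
theorem resScalars_comp {R k : Type} [CommRing R] [CommRing k] [Algebra R k] {Γ 𝒢 : Type}
    [Group Γ] [Group 𝒢] (ι : Γ →* 𝒢) {V : Type} [AddCommGroup V] [Module k V] [Module R V]
    [IsScalarTower R k V] (π : Representation k 𝒢 V) :
    resScalars R (π.comp ι) = (resScalars R π).comp ι :=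
  rfl

end Helpers

/-! ### The assembly -/

/-- **`bianchi_regularAlgebraicCuspidal_isHeckePoint` holds, given the Eichler–Shimura–Harder
eigenclass and the Borel–Serre finiteness of torsion-free arithmetic subgroups of `GL_n(K)`.**
See the module docstring. [cite: Scholze2015, §V.4, Cor. V.4.2 with the proof of Thm. V.4.1]
[cite: BorelSerre1973, §11.1 (c), 11.6] -/
theorem bianchi_regularAlgebraicCuspidal_isHeckePoint_of_eigenclassExists_of_typeFL
    (hX : bianchi_cuspidal_regularLAlgebraic_eigenclassExists)
    (hFL : ∀ (k : Type) [CommRing k] (n : ℕ) (K : Type) [Field K] [NumberField K]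
      (Γ : Subgroup (GL (Fin n) K)),
      Γ.Commensurable (Matrix.GeneralLinearGroup.map (algebraMap (𝓞 K) K) :
        GL (Fin n) (𝓞 K) →* GL (Fin n) K).range →
      (∀ g : Γ, IsOfFinOrder g → g = 1) →
      ∃ P : ProjectiveResolution (Rep.trivial k Γ k),
        ∀ i, ∃ m : ℕ, Nonempty (P.complex.X i ≅ Rep.free k Γ (Fin m))) :
    bianchi_regularAlgebraicCuspidal_isHeckePoint := by
  intro K _ _ htc hdeg p _ ι hcpt π hπ S₀ hpS hunr
  classical
  have hp : p.Prime := Fact.out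
  by_cases h0 : (0 : ℕ) ∈ S₀
  · exact bianchi_regularAlgebraicCuspidal_isHeckePoint_of_zero_mem K p ι hcpt π S₀ h0
  obtain ⟨U, hUo', hUc', hU', hcl', hU1', -, wt, -, hρ⟩ :=
    bianchi_regularAlgebraicCuspidal_eigenclass_of_eigenclassExists hX K htc hdeg p ι hcpt π hπ S₀
      h0 hunr
  -- ### notation
  let good : HeightOneSpectrum (𝓞 K) → Prop := fun v => ∀ ℓ ∈ S₀, ((ℓ : ℕ) : 𝓞 K) ∉ v.asIdeal
  have hgood : ∀ v, good v → ((p : ℕ) : 𝓞 K) ∉ v.asIdeal := fun v hv => hv p hpS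
  -- ### the neat level `U₀ = U ∩ K_f(p²)`
  let 𝔫 : Ideal (𝓞 K) := Ideal.span {((p : ℕ) : 𝓞 K)} ^ 2
  have h𝔫 : 𝔫 ≠ 0 := pow_ne_zero 2 (by
    rw [Ne, Ideal.zero_eq_bot, Ideal.span_singleton_eq_bot]; exact_mod_cast hp.ne_zero)
  have hdvd𝔫 : ∀ v : HeightOneSpectrum (𝓞 K), v.asIdeal ∣ 𝔫 → ((p : ℕ) : 𝓞 K) ∈ v.asIdeal := by
    intro v hv
    have h := (Ideal.dvd_iff_le.1 hv) (Ideal.pow_mem_pow (Ideal.mem_span_singleton_self _) 2)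
    exact (v.isPrime.mem_or_mem (by simpa [pow_two] using h)).elim id id
  let U₀ : Subgroup (FiniteAdelicGL 2 K) :=
    U ⊓ (principalCongruenceLevel 2 K 𝔫).comap (GLn.ofFinite 2 K)
  have hle₀ : U₀ ≤ U := inf_le_left
  have hU₀K : U₀ ≤ (principalCongruenceLevel 2 K 𝔫).comap (GLn.ofFinite 2 K) := inf_le_right
  have hU₀o : IsOpen (U₀ : Set (FiniteAdelicGL 2 K)) := isOpen_inf_comap_principalCongruenceLevel hUo' h𝔫
  have hU₀c : IsCompact (U₀ : Set (FiniteAdelicGL 2 K)) :=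
    isCompact_inf_comap_principalCongruenceLevel hUc' h𝔫
  have hU₀ : U₀ ≤ glFiniteIntegralLevel 2 K := hle₀.trans hU'
  have hcl : ∀ g ∈ glFiniteIntegralLevel 2 K,
      (∀ v : HeightOneSpectrum (𝓞 K), ¬ (∀ ℓ ∈ S₀, ((ℓ : ℕ) : 𝓞 K) ∉ v.asIdeal) →
        ∀ i j : Fin 2, ((g : Matrix (Fin 2) (Fin 2) (FiniteAdeleRing (𝓞 K) K)) i j) v =
          (1 : Matrix (Fin 2) (Fin 2) (v.adicCompletion K)) i j) → g ∈ U₀ := by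
    intro g hg hgS
    refine ⟨hcl' g hg hgS, mem_comap_principalCongruenceLevel_of_localComponent h𝔫 hg fun v hv => ?_⟩
    have hv' : ¬ ∀ ℓ ∈ S₀, ((ℓ : ℕ) : 𝓞 K) ∉ v.asIdeal := fun h => h p hpS (hdvd𝔫 v hv)
    exact Matrix.GeneralLinearGroup.ext fun i j => by
      rw [coe_localComponent_apply, hgS v hv' i j, Units.val_one]
  have hU1 : ∀ v : HeightOneSpectrum (𝓞 K), good v →
      ∀ g ∈ valuedCongruenceSubgroup (Fin 2) (1 : WithZero (Multiplicative ℤ)), ofLocal 2 K v g ∈ U₀ :=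
    fun v hv g hg => ⟨hU1' v hv g hg,
      (isUnramifiedLevel_comap_principalCongruenceLevel h𝔫 (fun h => hgood v hv (hdvd𝔫 v h))).map_mem hg⟩
  -- unramifiedness of `U` and `U₀` at the good places (Hecke compatibility of the pull-back)
  have hunrU : ∀ v, good v → ArithmeticQuotient.IsUnramifiedLevel
      (valuedCongruenceSubgroup (Fin 2) (1 : WithZero (Multiplicative ℤ))) (ofLocal 2 K v)
      (localComponent 2 K v) U := fun v hv =>
    isUnramifiedLevel_of_le (by rintro _ ⟨g, hg, rfl⟩; exact hU1' v hv g hg)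
      fun u hu => localComponent_mem_valuedCongruenceSubgroup_one (hU' hu) v
  have hunrU₀ : ∀ v, good v → ArithmeticQuotient.IsUnramifiedLevel
      (valuedCongruenceSubgroup (Fin 2) (1 : WithZero (Multiplicative ℤ))) (ofLocal 2 K v)
      (localComponent 2 K v) U₀ := fun v hv =>
    isUnramifiedLevel_of_le (by rintro _ ⟨g, hg, rfl⟩; exact hU1 v hv g hg)
      fun u hu => localComponent_mem_valuedCongruenceSubgroup_one (hU₀ hu) v
  haveI hfiU : (U₀.subgroupOf U).FiniteIndex := Subgroup.finiteIndex_subgroupOf_of_isCompact_isOpen hUc' hU₀o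
  refine ⟨U₀, hU₀o, hU₀, hcl, fun ϖ hϖ => ?_⟩
  let gE := globalEmbedding 2 K
  let V := CoeffModule (PadicAlgCl p) 2 K wt
  let πV : Representation (PadicAlgCl p) (FiniteAdelicGL 2 K) V := padicCoeffRep 2 K p wt
  let ρp : Representation (PadicAlgCl p) (GL (Fin 2) K) V := πV.comp gE
  -- the Satake parameters at the good places and the prospective values `b`
  have hsat : ∀ v, good v → ∃ α : Multiset ℂ, π.1.HasSatakeParamAt v α := fun v hv => hunr v hv
  let αv : HeightOneSpectrum (𝓞 K) → Multiset ℂ := fun v =>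
    if h : good v then (hsat v h).choose else 0
  have hαv : ∀ v, good v → π.1.HasSatakeParamAt v (αv v) := fun v hv => by
    simp only [αv, dif_pos hv]; exact (hsat v hv).choose_spec
  let bval : HeightOneSpectrum (𝓞 K) → ℕ → PadicAlgCl p := fun v i =>
    if i = 1 then ι.symm ((((Real.sqrt (v.residueCard : ℝ)) : ℝ) : ℂ) * (αv v).esymm 1)
    else ι.symm ((αv v).esymm 2)
  -- ### the eigenclass over `ℚ̄_p`, in the `p`-adic coefficient representation, at level `U`
  obtain ⟨q, ξ, hξ, heigξ⟩ := hρ _ rfl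
  let Φ := ResGLnCohomology.cohomologyIsoPadic 2 K p wt U (ρ := _) rfl q
  let ξU : TwistedQuotient.cohomology gE U ρp q := Φ.inv.hom ξ
  have hξU : ξU ≠ 0 := cohomologyIsoPadic_inv_apply_ne_zero 2 K p wt U rfl q hξ
  let J := {v // good v} × Fin 2
  let δ : J → FiniteAdelicGL 2 K := fun j => GLn.sndHom 2 K (heckeDiagAt 2 K j.1.1 (ϖ j.1.1) (j.2.val + 1))
  let χ : J → PadicAlgCl p := fun j => bval j.1.1 (j.2.val + 1)
  have heigU : ∀ j : J, TwistedQuotient.heckeEnd gE U ρp (δ j) q ξU = χ j • ξU := by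
    rintro ⟨⟨v, hv⟩, i⟩
    obtain ⟨h1, h2⟩ := heigξ ϖ hϖ v hv (αv v) (hαv v hv)
    fin_cases i
    · change TwistedQuotient.heckeEnd gE U ρp (GLn.sndHom 2 K (heckeDiagAt 2 K v (ϖ v) 1)) q
        (Φ.inv.hom ξ) = bval v 1 • Φ.inv.hom ξ
      rw [← cohomologyIsoPadic_inv_heckeEnd, h1, map_smul]
      rfl
    · change TwistedQuotient.heckeEnd gE U ρp (GLn.sndHom 2 K (heckeDiagAt 2 K v (ϖ v) 2)) q
        (Φ.inv.hom ξ) = bval v 2 • Φ.inv.hom ξ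
      rw [← cohomologyIsoPadic_inv_heckeEnd, h2, map_smul]
      rfl
  -- no `ℕ`-torsion in the `ℚ̄_p`-cohomology
  have hWn : ∀ (L' : Subgroup (FiniteAdelicGL 2 K)) (m : ℕ), m ≠ 0 →
      ∀ w : TwistedQuotient.cohomology gE L' ρp q, m • w = 0 → w = 0 := fun L' m hm w h => by
    rw [← Nat.cast_smul_eq_nsmul (PadicAlgCl p)] at h
    exact (smul_eq_zero.1 h).resolve_left (Nat.cast_ne_zero.2 hm)
  have hWp : ∀ (m : ℕ) (w : TwistedQuotient.cohomology gE U₀ ρp q), w ≠ 0 →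
      ((p : ℕ) : PadicAlgCl p) ^ m • w ≠ 0 := fun m w hw h => hw (by
    have hp0 : ((p : ℕ) : PadicAlgCl p) ^ m ≠ 0 := pow_ne_zero m (Nat.cast_ne_zero.2 hp.ne_zero)
    exact (smul_eq_zero.1 h).resolve_left hp0)
  -- ### pull back to the neat level `U₀` (injective, Hecke-equivariant at the good places)
  let ξ' : TwistedQuotient.cohomology gE U₀ ρp q := (pullbackMap gE ρp hle₀ q).hom ξU
  have hξ' : ξ' ≠ 0 := fun h =>
    hξU (pullbackMap_injective gE ρp hle₀ q (hWn U _ hfiU.index_ne_zero) (by rw [map_zero]; exact h))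
  have heig' : ∀ j : J, TwistedQuotient.heckeEnd gE U₀ ρp (δ j) q ξ' = χ j • ξ' := by
    rintro ⟨⟨v, hv⟩, i⟩
    have hδ : δ (⟨v, hv⟩, i) = ofLocal 2 K v
        (glDiagonal 2 (v.adicCompletion K) fun l => if (l : ℕ) < i.val + 1 then ϖ v else 1) :=
      sndHom_heckeDiagAt_eq_ofLocal v (ϖ v) (i.val + 1)
    have h := heigU (⟨v, hv⟩, i)
    rw [hδ] at h ⊢
    change TwistedQuotient.heckeEnd gE U₀ ρp _ q ((pullbackMap gE ρp hle₀ q).hom ξU) =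
      χ (⟨v, hv⟩, i) • (pullbackMap gE ρp hle₀ q).hom ξU
    rw [← pullbackMap_heckeEnd_of_isUnramifiedLevel gE ρp hle₀ (hunrU v hv) (hunrU₀ v hv) _
      (finite_doubleCosetQuot_of_isCompact_isOpen U hUc' hUo' _) q ξU, h, map_smul]
  -- ### orbit representatives for `(GL₂(K), U₀)`
  obtain ⟨sq, hsq⟩ := exists_finset_orbit_cover K U₀ hU₀o
  obtain ⟨sO, -, hdisj, hcov⟩ := exists_orbit_representatives_ind gE U₀ (sq.image Quotient.out)
    (fun g => by
      obtain ⟨x, hx, γ, hγ⟩ := hsq (g : FiniteAdelicGL 2 K ⧸ U₀)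
      refine ⟨x.out, Finset.mem_image_of_mem _ hx, γ, ?_⟩
      rw [QuotientGroup.out_eq']
      exact hγ)
  -- ### Stage 1: the eigenvalues lie in a finite `E₁ ⊇ coeffField` and are integral
  obtain ⟨E₁, hE₁fin, hE₁, hχE₁, hχint⟩ : ∃ (E₁ : IntermediateField ℚ_[p] (PadicAlgCl p)),
      FiniteDimensional ℚ_[p] E₁ ∧ coeffField K p ≤ E₁ ∧ (∀ j, χ j ∈ E₁) ∧
      ∀ j, IsIntegral ℤ_[p] (χ j) := by
    -- work over `k₀ = 𝒪_{E₀}`, `E₀ = coeffField`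
    let E₀ := coeffField K p
    haveI : FiniteDimensional ℚ_[p] E₀ := finiteDimensional_coeffField K p
    let k₀ := unitBall p E₀
    haveI : IsNoetherianRing k₀ := isNoetherianRing_unitBall p E₀
    let M₀ : Submodule k₀ V := coeffIntForm (PadicAlgCl p) k₀ 2 K wt
    have hM₀ : ∀ u ∈ U₀, ∀ m ∈ M₀, resScalars k₀ πV u m ∈ M₀ := fun u hu m hm =>
      padicCoeffRep_mem_coeffIntForm_unitBall p E₀ le_rfl wt (hU₀ hu) hm
    -- the comparison of the `k₀`- and the `ℚ̄_p`-cohomology, at the types of the lattice files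
    let rS : groupCohomology (coeffRep gE U₀ ((resScalars k₀ πV).comp gE)) q →ₛₗ[algebraMap k₀ (PadicAlgCl p)]
        TwistedQuotient.cohomology gE U₀ ρp q := cohomologyResScalars k₀ gE U₀ ρp q
    have hrSsurj : Function.Surjective rS := (cohomologyResScalars_bijective k₀ gE U₀ ρp q).2
    have hrST : ∀ (g : FiniteAdelicGL 2 K) (x : groupCohomology (coeffRep gE U₀ ((resScalars k₀ πV).comp gE)) q),
        rS (TwistedQuotient.heckeEnd gE U₀ ((resScalars k₀ πV).comp gE) g q x) =
          TwistedQuotient.heckeEnd gE U₀ ρp g q (rS x) := fun g x =>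
      cohomologyResScalars_heckeEnd k₀ gE U₀ ρp g q x
    -- the class over `k₀` and a lattice cohomology class above it
    obtain ⟨y₀, hy₀⟩ := hrSsurj ξ'
    obtain ⟨s, y, hy⟩ := exists_intFun_map_eq gE U₀ πV M₀ hM₀ sO hdisj hcov
      (fun x _ => hFL (unitBall p E₀) 2 K _ (commensurable_orbitStabilizer_glIntegers U₀ hU₀o hU₀c _)
        (orbitStabilizer_torsionFree p hU₀K x)) (span_coeffIntForm_eq_top (PadicAlgCl p) k₀ 2 K wt) q y₀
    -- the finitely generated image `L` of `H^q(intFun M_s)` in the `ℚ̄_p`-cohomology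
    let Hs := groupCohomology (intFun gE U₀ (resScalars k₀ πV) (scaledLattice M₀ s)) q
    let fI := cohMapQ (intFunι gE U₀ (resScalars k₀ πV) (scaledLattice M₀ s)) q
    let fS : Hs →ₗ[k₀] TwistedQuotient.cohomology gE U₀ ρp q :=
      { toFun := fun z => rS (fI z)
        map_add' := fun z z' => by simp only [map_add]
        map_smul' := fun c z => by rw [map_smul, map_smulₛₗ, RingHom.id_apply, algebraMap_smul] }
    haveI : Module.Finite k₀ Hs := moduleFinite_cohomology_intFun_scaledLattice gE U₀ πV M₀ hM₀ sO
      hdisj hcov (fun x _ => hFL (unitBall p E₀) 2 K _ (commensurable_orbitStabilizer_glIntegers U₀ hU₀o hU₀c _)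
        (orbitStabilizer_torsionFree p hU₀K x)) (coeffIntForm_fg (PadicAlgCl p) k₀ 2 K wt) q s
    let L : Submodule k₀ (TwistedQuotient.cohomology gE U₀ ρp q) := LinearMap.range fS
    have hLfg : L.FG := Module.Finite.iff_fg.1 inferInstance
    have hξ'L : ξ' ∈ L := ⟨y, by change rS (fI y) = ξ'; rw [hy]; exact hy₀⟩
    have hLT : ∀ j : J, ∀ w ∈ L, TwistedQuotient.heckeEnd gE U₀ ρp (δ j) q w ∈ L := by
      rintro j _ ⟨z, rfl⟩
      refine ⟨cohMapQ (heckeIntHom gE U₀ (resScalars k₀ πV) (scaledLattice M₀ s)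
        (scaledLattice_stable M₀ πV U₀ hM₀ s) (g₀ := δ j) (rep_mem_of_eq_one _ _
          (resScalars_unitBall_padicCoeffRep_sndHom_heckeDiagAt p E₀ wt (hgood _ j.1.2) (ϖ j.1.1)
            (j.2.val + 1)))) q z, ?_⟩
      change rS (fI (cohMapQ _ q z)) = TwistedQuotient.heckeEnd gE U₀ ρp (δ j) q (rS (fI z))
      rw [← hrST]
      congr 1
      change cohMapQ _ q (cohMapQ _ q z) = cohMapQ _ q (cohMapQ _ q z)
      rw [← cohMapQ_comp, heckeIntHom_comp_intFunι, cohMapQ_comp]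
    -- the finitely generated module of scalars moving `ξ'` into `L` contains all the eigenvalues
    let Sc : Submodule k₀ (PadicAlgCl p) := scalingSubmodule (PadicAlgCl p) L ξ'
    have hχSc : ∀ j, χ j ∈ Sc := fun j =>
      eigenvalue_mem_scalingSubmodule L ξ' (TwistedQuotient.heckeEnd gE U₀ ρp (δ j) q) (hLT j) hξ'L
        (χ j) (heig' j)
    obtain ⟨G, hG⟩ := scalingSubmodule_fg (PadicAlgCl p) L ξ' hLfg hξ'
    let E : IntermediateField ℚ_[p] (PadicAlgCl p) := E₀ ⊔ IntermediateField.adjoin ℚ_[p] (G : Set (PadicAlgCl p))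
    haveI : FiniteDimensional ℚ_[p] (IntermediateField.adjoin ℚ_[p] (G : Set (PadicAlgCl p))) :=
      IntermediateField.finiteDimensional_adjoin fun x _ =>
        (Algebra.IsAlgebraic.isAlgebraic (R := ℚ_[p]) x).isIntegral
    -- `E` as a `k₀`-submodule of `ℚ̄_p` (`k₀ ⊆ E₀ ⊆ E`)
    let Ek : Submodule k₀ (PadicAlgCl p) :=
      { carrier := (E : Set (PadicAlgCl p))
        zero_mem' := E.zero_mem
        add_mem' := fun ha hb => E.add_mem ha hb
        smul_mem' := fun c x hx => by
          rw [Subring.smul_def, smul_eq_mul]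
          exact E.mul_mem ((le_sup_left : E₀ ≤ E) (mem_of_mem_unitBall p E₀ c.2)) hx }
    have hScE : Sc ≤ Ek := by
      show scalingSubmodule (PadicAlgCl p) L ξ' ≤ Ek
      rw [← hG, Submodule.span_le]
      intro g hg
      exact (le_sup_right : IntermediateField.adjoin ℚ_[p] (G : Set (PadicAlgCl p)) ≤ E)
        (IntermediateField.subset_adjoin ℚ_[p] _ hg)
    refine ⟨E, IntermediateField.finiteDimensional_sup E₀ _, le_sup_left, fun j => hScE (hχSc j),
      fun j => ?_⟩
    have hint : IsIntegral k₀ (χ j) :=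
      isIntegral_eigenvalue L ξ' hLfg hξ'L hξ' (TwistedQuotient.heckeEnd gE U₀ ρp (δ j) q) (hLT j)
        (χ j) (heig' j)
    haveI : Algebra.IsIntegral ℤ_[p] k₀ := Algebra.IsIntegral.of_finite ℤ_[p] k₀
    exact isIntegral_trans (χ j) hint
  -- ### Stage 2: over `k₁ = 𝒪_{E₁}`
  haveI := hE₁fin
  let k₁ := unitBall p E₁
  have hχ₁ : ∀ j, χ j ∈ k₁ := fun j => mem_unitBall_of_isIntegral p E₁ (hχE₁ j) (hχint j)
  let χ₁ : J → k₁ := fun j => ⟨χ j, hχ₁ j⟩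
  let M₁ : Submodule k₁ V := coeffIntForm (PadicAlgCl p) k₁ 2 K wt
  have hM₁ : ∀ u ∈ U₀, ∀ m ∈ M₁, resScalars k₁ πV u m ∈ M₁ := fun u hu m hm =>
    padicCoeffRep_mem_coeffIntForm_unitBall p E₁ hE₁ wt (hU₀ hu) hm
  let rS₁ : groupCohomology (coeffRep gE U₀ ((resScalars k₁ πV).comp gE)) q →ₛₗ[algebraMap k₁ (PadicAlgCl p)]
      TwistedQuotient.cohomology gE U₀ ρp q := cohomologyResScalars k₁ gE U₀ ρp q
  have hrS₁bij : Function.Bijective rS₁ := cohomologyResScalars_bijective k₁ gE U₀ ρp q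
  have hrS₁T : ∀ (g : FiniteAdelicGL 2 K) (x : groupCohomology (coeffRep gE U₀ ((resScalars k₁ πV).comp gE)) q),
      rS₁ (TwistedQuotient.heckeEnd gE U₀ ((resScalars k₁ πV).comp gE) g q x) =
        TwistedQuotient.heckeEnd gE U₀ ρp g q (rS₁ x) := fun g x =>
    cohomologyResScalars_heckeEnd k₁ gE U₀ ρp g q x
  obtain ⟨ξ₁, hξ₁⟩ := hrS₁bij.2 ξ'
  have hξ₁p : ∀ m : ℕ, (p : k₁) ^ m • ξ₁ ≠ 0 := by
    intro m hm
    have h := congrArg rS₁ hm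
    rw [map_smulₛₗ, map_zero, map_pow, map_natCast, hξ₁] at h
    exact hWp m ξ' hξ' h
  have heig₁ : ∀ j, TwistedQuotient.heckeEnd gE U₀ ((resScalars k₁ πV).comp gE) (δ j) q ξ₁ = χ₁ j • ξ₁ := by
    intro j
    apply hrS₁bij.1
    rw [hrS₁T, map_smulₛₗ, hξ₁, heig' j]
    rfl
  have hδ₁ : ∀ j : J, resScalars k₁ πV (δ j) = 1 := fun j =>
    resScalars_unitBall_padicCoeffRep_sndHom_heckeDiagAt p E₁ wt (hgood _ j.1.2) (ϖ j.1.1) _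
  haveI : Module.IsTorsionFree k₁ V := by
    rw [Module.isTorsionFree_iff_smul_eq_zero]
    intro c v hcv
    rcases eq_or_ne c 0 with rfl | hc
    · exact Or.inl rfl
    · right
      rw [Subring.smul_def] at hcv
      exact (smul_eq_zero.1 hcv).resolve_left (fun h => hc (Subtype.ext h))
  -- the congruences `K_f((p)^r)` on `M₁`
  let Lev : ℕ → Subgroup (FiniteAdelicGL 2 K) := fun r =>
    U₀ ⊓ (principalCongruenceLevel 2 K (Ideal.span {((p : ℕ) : 𝓞 K)} ^ r)).comap (GLn.ofFinite 2 K)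
  have hcong : ∀ t' : ℕ, ∃ r : ℕ, ∀ l ∈ U₀, l ∈ Lev r → ∀ m ∈ M₁,
      πV l m - m ∈ (Ideal.span {((p ^ t' : ℕ) : k₁)} : Ideal k₁) • M₁ := by
    intro t'
    refine ⟨t', fun l hl hl' m hm => ?_⟩
    rw [Nat.cast_pow]
    exact padicCoeffRep_sub_mem_smul_coeffIntForm_unitBall p E₁ hE₁ wt t' (hU₀ hl) hl'.2 hm
  obtain ⟨M', hM', d, e, c, m₀, -, hmod, heigc, -, hcont⟩ :=
    exists_intFun_exact_eigenclass gE U₀ πV M₁ hM₁ sO hdisj hcov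
      (fun x _ => hFL (unitBall p E₁) 2 K _ (commensurable_orbitStabilizer_glIntegers U₀ hU₀o hU₀c _)
        (orbitStabilizer_torsionFree p hU₀K x)) (coeffIntForm_fg (PadicAlgCl p) k₁ 2 K wt)
      (span_coeffIntForm_eq_top (PadicAlgCl p) k₁ 2 K wt) (natCast_prime_mem_maximalIdeal p E₁)
      δ hδ₁ χ₁ Lev hcong ξ₁ hξ₁p heig₁
  -- ### the `ℤ̄_p`-point
  have hpoint := isHeckePoint_principalPowerTower_of_intFun_eigenclass_unitBall p E₁ wt good hgood
    hU₀o hU₀c hU₀ hU1 M' hM' e hmod ϖ (fun v i => if i = 1 then χ₁ (v, 0) else χ₁ (v, 1)) c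
    (fun j => by
      rcases j with ⟨v, i⟩
      fin_cases i
      · exact heigc (v, 0)
      · exact heigc (v, 1)) hcont
  refine ⟨fun v i => algebraMap k₁ _ (if i = 1 then χ₁ (v, 0) else χ₁ (v, 1)), fun v hv α hα => ?_, ?_⟩
  · -- the values: `ι(b_{v,1}) = q_v^{1/2} e₁(α)`, `ι(b_{v,2}) = e₂(α)` (Satake uniqueness)
    have hαeq : α = αv v := AutomorphicRepData.hasSatakeParamAt_unique_holds π.1 hα (hαv v hv)
    subst hαeq
    constructor
    · change ι ((χ₁ (⟨v, hv⟩, 0) : k₁) : PadicAlgCl p) = _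
      simp [χ₁, χ, bval]
    · change ι ((χ₁ (⟨v, hv⟩, 1) : k₁) : PadicAlgCl p) = _
      simp [χ₁, χ, bval]
  · exact hpoint

end Literature.NumberTheory.Automorphic
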